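import Mathlib.Algebra.MvPolynomial.Monad
import Mathlib.RingTheory.MvPolynomial.Symmetric.FundamentalTheorem
import Mathlib.RingTheory.Polynomial.Vieta
import Mathlib.SetTheory.Cardinal.NatCard
import Literature.NumberTheory.EllipticCurves.IsogenyHomProofs
import Literature.NumberTheory.EllipticCurves.PointDivisibilityProofs
import Literature.NumberTheory.EllipticCurves.TorsionCardinality
import HarnessLib

/-!
# Isogenies killing `E[m]` factor through `[m]`: proof of the named fact
`Isogeny.exists_eq_comp_nsmul_of_geomTorsion_le_ker` (Silverman, *AEC*, Cor. III.4.11 for `[m]`)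

Sibling file of `Literature.NumberTheory.EllipticCurves.IsogenyHom` (D-0014 append protocol). It
discharges the named fact `WeierstrassCurve.Isogeny.exists_eq_comp_nsmul_of_geomTorsion_le_ker`:
for elliptic curves `E, E'` over `K`, `m ≠ 0` in `K` and an isogeny `ψ : E → E'` over `K` with
`E[m] ⊆ ker ψ`, there is an isogeny `λ : E → E'` over `K` with `ψ = λ ∘ [m]` — Silverman, *AEC*,
Cor. III.4.11 (`φ, ψ` non-constant isogenies, `φ` separable, `ker φ ⊆ ker ψ` ⟹ `ψ = λ ∘ φ`, p. 72
of the held text) applied to `φ = [m]`, separable because `m ≠ 0` in `K` (Cor. III.5.4, p. 76) —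
in the encoding of the prelude `Isogeny` (an isogeny over `K` is an additive map on `K̄`-points
agreeing with a `K̄`-rational map off a finite set, `Γ_K`-equivariant, with finite kernel).

## The argument

Silverman's proof: `K̄(E)/[m]^*K̄(E)` is Galois with group `E[m]` acting by translations
(III.4.10(b),(c)), `ψ^*K̄(E')` is fixed by it, hence `ψ^*K̄(E') ⊆ [m]^*K̄(E)`, which gives `λ`
(II.2.4). Here the Galois descent is replaced by the explicit, characteristic-free **trace over the
fibres of `[m]`**, which needs neither function fields nor II.2.4:

1. *The map.* `[m]` is onto `E(K̄)` (tree: `nsmul_surjective_of_isAlgClosed`,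
   `PointDivisibilityProofs`) and `ψ` is constant on its fibres, so `λ(mP) := ψ(P)` is a well
   defined additive map `E(K̄) → E'(K̄)` (`Isogeny.factorNsmulHom`); it is `Γ_K`-equivariant
   because `ψ` and `[m]` are, and `ker λ = [m](ker ψ)` is finite.
2. *The fibres* (`exists_fibre_prod_eq`). For `Q = (u, v)` with `2Q ≠ O`, the fibre `[m]⁻¹(Q)` is
   a coset of `E[m]`, which has `m²` elements (tree: `card_torsionBy_eq_sq`, *AEC* III.6.4(b),
   `TorsionCardinality`); its points `Pᵢ = (xᵢ, yᵢ)` have pairwise distinct abscissae, all roots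
   of `Φₘ − u·ΨSqₘ` (`x([m]P) = Φₘ/ΨSqₘ`, Exercise 3.7(d), tree: `mul_eval_ΨSq_of_zsmul_eq`), a
   monic polynomial of degree `m²`; hence `Φₘ − u·ΨSqₘ = ∏ᵢ (T − xᵢ)`.
3. *Eliminating `y`* (`mul_eval_ΨSq_sq_of_zsmul_eq`, `linCoeff_one_ne_zero`). From
   `[m](x, y) = (φₘ/ψₘ², ωₘ/ψₘ³)` (Exercise 3.7(d), tree: `zsmul_some_eq_of_evalEval_ψ_ne_zero`,
   `DivisionPolynomialMultiplication`, with `ωₘ` specialised to a bivariate `ω̃ₘ`, `ωPoly`) and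
   `ψₘ² = ΨSqₘ(x)`: `y([m]P)·ΨSqₘ(x)² = αₘ(x) + βₘ(x)·y`, where `αₘ + βₘY` is `ω̃ₘψₘ` reduced modulo
   the Weierstrass equation; and `βₘ ≠ 0` (else `y([m]P)` would depend on `x(P)` only, so
   `[m]P = −[m]P`, `[2m]P = O` for all `P`, contradicting the finiteness of `E[2m]`). So on the
   fibre of a point where `βₘ(xᵢ) ≠ 0`, `yᵢ = (v·ΨSqₘ(xᵢ)² − αₘ(xᵢ))/βₘ(xᵢ)` and every fraction
   `N/D` of two-variable polynomials becomes a fraction `Ñ(xᵢ)/D̃(xᵢ)` with `Ñ, D̃ ∈ K̄[u, v][T]`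
   (`yElimPoly`).
4. *The trace* (`Literature.NumberTheory.EllipticCurves.symmDescend`, `Literature.NumberTheory.EllipticCurves.map_traceDescend_eq_of_forall_eq`, pure algebra). For
   `F ∈ R[T]` and `N, D ∈ R[T]`, the symmetric polynomials `∑ᵢ N(Tᵢ)∏_{j≠i} D(Tⱼ)` and `∏ⱼ D(Tⱼ)`
   are polynomials in the elementary symmetric ones (fundamental theorem of symmetric polynomials,
   Mathlib `MvPolynomial.esymmAlgEquiv`), which at the roots of `F^χ = ∏ (T − xᵢ)` are the signed
   coefficients of `F^χ` (Vieta, Mathlib `Multiset.prod_X_sub_C_coeff`); this yields `A, B ∈ R`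
   with `χ(B) = ∏ D^χ(xⱼ)` and `χ(A) = ∑ᵢ N^χ(xᵢ) ∏_{j≠i} D^χ(xⱼ)` for every `χ : R → K̄`. With
   `R = K̄[u, v]`, `χ = ` evaluation at `(u, v) = Q`: if `N/D` takes the same value `c` at all
   `m²` points of the fibre, then `χ(A) = m²·c·χ(B)`, `χ(B) ≠ 0`.
5. *Assembly* (`Isogeny.isAlgebraicOn_factorNsmulHom`). If `ψ = (P₁/Q₁, P₂/Q₂)` off the finite
   set `S`, then off the finite set `{O} ∪ E[2] ∪ [m](S) ∪ [m]{βₘ(x) = 0}` the coordinates of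
   `λ(Q) = ψ(Pᵢ)` are the common values of `P₁/Q₁`, `P₂/Q₂` on the fibre, hence equal to
   `A(Q)/(m²B(Q))`: `λ` agrees with a rational map off a finite set (`m² ≠ 0` in `K`), so `λ` is an
   isogeny over `K` (`Isogeny.factorNsmul`) with `ψ = λ ∘ [m]`
   (`Isogeny.exists_eq_comp_nsmul_of_geomTorsion_le_ker_holds`).

## References

* [SilvermanAEC2009] J. H. Silverman, *The Arithmetic of Elliptic Curves*, 2nd ed., GTM 106,
  Springer 2009, doi:10.1007/978-0-387-09494-6: Cor. III.4.11 and Thm. III.4.10 (p. 72 of the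
  held text), Cor. III.5.4 (p. 76), Cor. III.6.4(b) (p. 81), Exercise 3.7 (p. 97; book p. 105).

## Design

* `noncomputable section`, `open scoped Classical` (the group law on `Affine.Point`, `geomPoints`,
  `card_torsionBy_eq_sq` all use the classical `DecidableEq`), as in `IsogenyHomProofs` and
  `TorsionCardinality`.
* The symmetric-function algebra is generic (`namespace Literature`, any commutative ring `R`, any
  `F N D ∈ R[T]`); the curve-level statements (`ωPoly`, `linCoeff`, the fibre, `yElimPoly`,
  `nsmulTraceNum`/`nsmulTraceDen`) are deliberate dot-notation extensions in
  `namespace WeierstrassCurve` for any Weierstrass curve over a field (algebraically closed where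
  needed), and only the last section specialises to `W.baseChange K̄` and the prelude's
  `geomPoints`/`Isogeny`.
* No new instances; no auxiliary structure: the rational map for `λ` is the explicit pair of
  fractions `nsmulTraceNum Pₖ Qₖ / nsmulTraceDen Qₖ` in `MvPolynomial (Fin 2) K̄` (`u = X 0`,
  `v = X 1`), matching `IsAlgebraicOn`.
-/

noncomputable section

open scoped Classical
open scoped Polynomial Polynomial.Bivariate

/-! ## Symmetric functions of the roots: the trace lemma -/

namespace Literature.NumberTheory.EllipticCurves

open MvPolynomial Finset

section SymmDescend

variable {R : Type*} [CommRing R] {d : ℕ}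

/-- Given `F ∈ R[T]` (to be thought of as monic of degree `d`) and a symmetric polynomial `p` in
`d` variables over `R`: the element of `R` obtained by writing `p` as a polynomial in the
elementary symmetric polynomials (fundamental theorem of symmetric polynomials, Mathlib
`MvPolynomial.esymmAlgEquiv`) and substituting for `e_{i+1}` the signed coefficient
`(-1)^{i+1} · coeff(F, d - (i+1))` (Vieta). [folklore] -/
def symmDescend (F : R[X]) (p : MvPolynomial (Fin d) R) (hp : p.IsSymmetric) : R :=
  aeval (fun i : Fin d ↦ (-1) ^ ((i : ℕ) + 1) * F.coeff (d - (i + 1)))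
    ((esymmAlgEquiv (Fin d) R (Fintype.card_fin d)).symm ⟨p, hp⟩)

/-- **Specification of `symmDescend`.** Whenever `F` becomes `∏ᵢ (T - xᵢ)` under a ring map
`χ : R → S`, `χ (symmDescend F p) = p(x₁, …, x_d)` (fundamental theorem of symmetric polynomials
and Vieta's formulae). [folklore] -/
theorem map_symmDescend {S : Type*} [CommRing S] (F : R[X]) (p : MvPolynomial (Fin d) R)
    (hp : p.IsSymmetric) (χ : R →+* S) (x : Fin d → S)
    (hx : F.map χ = ∏ i, (Polynomial.X - Polynomial.C (x i))) :
    χ (symmDescend F p hp) = eval₂Hom χ x p := by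
  set e := esymmAlgEquiv (Fin d) R (Fintype.card_fin d) with he
  set G := e.symm ⟨p, hp⟩ with hG
  -- `p` is `G` evaluated at the elementary symmetric polynomials
  have hpG : aeval (fun i : Fin d ↦ esymm (Fin d) R (i + 1)) G = p := by
    have h1 := congrArg Subtype.val (e.apply_symm_apply ⟨p, hp⟩)
    rw [he, esymmAlgEquiv_apply, esymmAlgHom_apply] at h1
    exact h1
  -- Vieta: the signed coefficients of `F^χ = ∏ (T - xᵢ)` are the elementary symmetric functions
  have hcoeff : ∀ i : Fin d, χ ((-1) ^ ((i : ℕ) + 1) * F.coeff (d - (i + 1))) =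
      ((univ : Finset (Fin d)).val.map x).esymm (i + 1) := by
    intro i
    have hcard : Multiset.card ((univ : Finset (Fin d)).val.map x) = d := by
      rw [Multiset.card_map, card_val, card_univ, Fintype.card_fin]
    have hprod : F.map χ = (((univ : Finset (Fin d)).val.map x).map
        fun t ↦ Polynomial.X - Polynomial.C t).prod := by
      rw [hx, Multiset.map_map, Finset.prod_eq_multiset_prod]; rfl
    have hi : (i : ℕ) + 1 ≤ d := i.2
    have hc := Multiset.prod_X_sub_C_coeff (((univ : Finset (Fin d)).val.map x))
      (k := d - (i + 1)) (by rw [hcard]; exact Nat.sub_le _ _)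
    rw [← hprod, hcard, Nat.sub_sub_self hi, Polynomial.coeff_map] at hc
    rw [map_mul, map_pow, map_neg, map_one, hc, ← mul_assoc, ← pow_add, ← two_mul, pow_mul,
      neg_one_sq, one_pow, one_mul]
  -- evaluate both sides at the elementary symmetric functions of `x`
  have lhs : χ (symmDescend F p hp) =
      eval₂Hom χ (fun i : Fin d ↦ ((univ : Finset (Fin d)).val.map x).esymm (i + 1)) G := by
    rw [symmDescend, ← hG, aeval_def, eval₂_comp_left, coe_eval₂Hom]
    congr 1
    funext i
    exact hcoeff i
  have rhs : eval₂Hom χ x p =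
      eval₂Hom χ (fun i : Fin d ↦ ((univ : Finset (Fin d)).val.map x).esymm (i + 1)) G := by
    rw [← hpG, aeval_eq_bind₁, eval₂Hom_bind₁]
    congr 2
    funext i
    rw [coe_eval₂Hom, eval₂_eq_eval_map, map_esymm, ← aeval_eq_eval, aeval_esymm_eq_multiset_esymm]
  rw [lhs, rhs]

/-- The product `∏ⱼ D(Tⱼ)` as a (symmetric) polynomial in `T₁, …, T_d`. [folklore] -/
def normPoly (d : ℕ) (D : R[X]) : MvPolynomial (Fin d) R := ∏ j : Fin d, Polynomial.aeval (X j) D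

/-- `∑ᵢ N(Tᵢ) ∏_{j ≠ i} D(Tⱼ)`, the numerator of `∑ᵢ N(Tᵢ)/D(Tᵢ)`, as a (symmetric) polynomial in
`T₁, …, T_d`. [folklore] -/
def tracePoly (d : ℕ) (N D : R[X]) : MvPolynomial (Fin d) R :=
  ∑ i : Fin d, Polynomial.aeval (X i) N * ∏ j ∈ univ.erase i, Polynomial.aeval (X j) D

/-- Renaming variables in `D(Tᵢ)` gives `D(T_{e i})`. [folklore] -/
theorem rename_aeval_X (e : Fin d → Fin d) (i : Fin d) (D : R[X]) :
    rename e (Polynomial.aeval (X i : MvPolynomial (Fin d) R) D) =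
      Polynomial.aeval (X (e i)) D := by
  rw [← Polynomial.aeval_algHom_apply, rename_X]

/-- `∏ⱼ D(Tⱼ)` is symmetric. [folklore] -/
theorem isSymmetric_normPoly (d : ℕ) (D : R[X]) : (normPoly d D).IsSymmetric := by
  intro e
  simp only [normPoly, map_prod, rename_aeval_X]
  exact Equiv.prod_comp e (fun j ↦ Polynomial.aeval (X j) D)

/-- `∑ᵢ N(Tᵢ) ∏_{j ≠ i} D(Tⱼ)` is symmetric. [folklore] -/
theorem isSymmetric_tracePoly (d : ℕ) (N D : R[X]) : (tracePoly d N D).IsSymmetric := by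
  intro e
  simp only [tracePoly, map_sum, map_mul, map_prod, rename_aeval_X]
  conv_rhs => rw [← Equiv.sum_comp e]
  refine Finset.sum_congr rfl fun i _ ↦ ?_
  congr 1
  exact Finset.prod_equiv e (by simp) (by simp)

/-- `B(F, D) ∈ R`: the descent of `∏ⱼ D(xⱼ)` over the roots `xⱼ` of `F` (the norm of `D`).
[folklore] -/
def normDescend (d : ℕ) (F D : R[X]) : R := symmDescend F (normPoly d D) (isSymmetric_normPoly d D)

/-- `A(F, N, D) ∈ R`: the descent of `∑ᵢ N(xᵢ) ∏_{j≠i} D(xⱼ)` over the roots `xⱼ` of `F` (the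
numerator of the trace of `N/D`). [folklore] -/
def traceDescend (d : ℕ) (F N D : R[X]) : R :=
  symmDescend F (tracePoly d N D) (isSymmetric_tracePoly d N D)

/-- Evaluating `D(Tᵢ)` at `T ↦ x` along `χ` gives `D^χ(xᵢ)`. [folklore] -/
theorem eval₂Hom_aeval_X {S : Type*} [CommRing S] (χ : R →+* S) (x : Fin d → S) (i : Fin d)
    (D : R[X]) : eval₂Hom χ x (Polynomial.aeval (X i : MvPolynomial (Fin d) R) D) =
      (D.map χ).eval (x i) := by
  rw [Polynomial.aeval_def, Polynomial.hom_eval₂, Polynomial.eval_map]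
  congr 1
  · ext r; simp
  · simp

/-- `χ(B) = ∏ⱼ D^χ(xⱼ)` at the roots of `F^χ = ∏ (T − xⱼ)`. [folklore] -/
theorem map_normDescend {S : Type*} [CommRing S] (F D : R[X]) (χ : R →+* S) (x : Fin d → S)
    (hx : F.map χ = ∏ i, (Polynomial.X - Polynomial.C (x i))) :
    χ (normDescend d F D) = ∏ j, (D.map χ).eval (x j) := by
  rw [normDescend, map_symmDescend F _ _ χ x hx, normPoly, map_prod]
  simp only [eval₂Hom_aeval_X]

/-- `χ(A) = ∑ᵢ N^χ(xᵢ) ∏_{j≠i} D^χ(xⱼ)` at the roots of `F^χ = ∏ (T − xⱼ)`. [folklore] -/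
theorem map_traceDescend {S : Type*} [CommRing S] (F N D : R[X]) (χ : R →+* S) (x : Fin d → S)
    (hx : F.map χ = ∏ i, (Polynomial.X - Polynomial.C (x i))) :
    χ (traceDescend d F N D) =
      ∑ i, (N.map χ).eval (x i) * ∏ j ∈ univ.erase i, (D.map χ).eval (x j) := by
  rw [traceDescend, map_symmDescend F _ _ χ x hx, tracePoly, map_sum]
  simp only [map_mul, map_prod, eval₂Hom_aeval_X]

/-- **Trace lemma.** If at the roots `x₁, …, x_d` of `F^χ = ∏ (T − xᵢ)` (over a domain `S`) one
has `D^χ(xᵢ) ≠ 0` and `N^χ(xᵢ) = c · D^χ(xᵢ)` for one and the same `c` — i.e. the fraction `N/D`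
takes the value `c` at every root — then `χ(B) ≠ 0` and `χ(A) = d · c · χ(B)`: the trace of the
constant `c` is `d·c`. [folklore] -/
theorem map_traceDescend_eq_of_forall_eq {S : Type*} [CommRing S] [IsDomain S] (F N D : R[X])
    (χ : R →+* S) (x : Fin d → S) (hx : F.map χ = ∏ i, (Polynomial.X - Polynomial.C (x i)))
    (c : S) (hD : ∀ i, (D.map χ).eval (x i) ≠ 0)
    (hN : ∀ i, (N.map χ).eval (x i) = c * (D.map χ).eval (x i)) :
    χ (normDescend d F D) ≠ 0 ∧ χ (traceDescend d F N D) = d * c * χ (normDescend d F D) := by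
  rw [map_normDescend F D χ x hx, map_traceDescend F N D χ x hx]
  refine ⟨prod_ne_zero_iff.mpr fun j _ ↦ hD j, ?_⟩
  have : ∀ i ∈ (univ : Finset (Fin d)),
      (N.map χ).eval (x i) * ∏ j ∈ univ.erase i, (D.map χ).eval (x j) =
        c * ∏ j, (D.map χ).eval (x j) := fun i hi ↦ by
    rw [hN i, mul_assoc, mul_prod_erase univ (fun j ↦ (D.map χ).eval (x j)) hi]
  rw [sum_congr rfl this, sum_const, card_univ, Fintype.card_fin, nsmul_eq_mul]
  ring

end SymmDescend

/-- Specialising the constants `u ↦ u₀` in a one-variable polynomial whose coefficients were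
lifted from `K` to `K[u₁, …, uₙ]` gives the polynomial back. [folklore] -/
theorem map_map_C_eval {K σ : Type*} [CommSemiring K] (q : K[X]) (g : σ → K) :
    (q.map (MvPolynomial.C : K →+* MvPolynomial σ K)).map (MvPolynomial.eval g) = q := by
  rw [Polynomial.map_map]
  conv_rhs => rw [← Polynomial.map_id (p := q)]
  congr 1
  ext a
  simp

end Literature.NumberTheory.EllipticCurves

/-! ## Curve-level inputs: `y ∘ [m]` linearised, and the fibres of `[m]` -/

namespace WeierstrassCurve

open Polynomial

universe v

section Curve

variable {K : Type v} [Field K] (V : WeierstrassCurve K)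

/-- The universal `ωₙ ∈ ℤ[A₁, A₂, A₃, A₄, X, Y]` of `DivisionPolynomialMultiplication`
(`Literature.UnivEC.ω n`) specialised to the coefficients of `V`: a bivariate polynomial `ω̃ₙ ∈ K[X][Y]`
with `ω̃ₙ(x, y) = ωₙ(x, y)` (`evalEval_ωPoly`), so that `[n](x, y) = (φₙ/ψₙ², ω̃ₙ/ψₙ³)(x, y)`.
Silverman, *AEC*, Exercise 3.7(d). [folklore] -/
def ωPoly (n : ℤ) : K[X][Y] :=
  MvPolynomial.eval₂Hom (Int.castRingHom K[X][Y])
    ![C (C V.a₁), C (C V.a₂), C (C V.a₃), C (C V.a₄), C X, Y] (Literature.NumberTheory.EllipticCurves.UnivEC.ω n)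

/-- `ω̃ₙ(x, y) = ωₙ(x, y)` (the tree's `Affine.Point.ωEval`). [folklore] -/
theorem evalEval_ωPoly (x y : K) (n : ℤ) :
    (V.ωPoly n).evalEval x y = Affine.Point.ωEval V x y n := by
  rw [ωPoly, Affine.Point.ωEval, Literature.NumberTheory.EllipticCurves.UnivEC.ev, ← coe_evalEvalRingHom, MvPolynomial.coe_eval₂Hom,
    MvPolynomial.eval₂_comp_left, MvPolynomial.coe_eval₂Hom]
  congr 1
  · exact RingHom.ext_int _ _
  · funext i
    fin_cases i <;> simp

/-- The coefficients `r₀, r₁ ∈ K[X]` (`i = 0, 1`) of the remainder `r₀ + r₁Y` of `p ∈ K[X][Y]`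
modulo the Weierstrass polynomial (monic and quadratic in `Y`). [folklore] -/
def linCoeff (p : K[X][Y]) (i : ℕ) : K[X] := (p %ₘ V.toAffine.polynomial).coeff i

/-- On the curve, `p(x, y) = r₀(x) + r₁(x)·y`. [folklore] -/
theorem evalEval_eq_linCoeff {x y : K} (h : V.toAffine.Equation x y) (p : K[X][Y]) :
    p.evalEval x y = (V.linCoeff p 0).eval x + (V.linCoeff p 1).eval x * y := by
  have hmonic := (V.toAffine).monic_polynomial
  have hdeg : (p %ₘ V.toAffine.polynomial).natDegree ≤ 1 := by
    have h1 := natDegree_modByMonic_lt p hmonic (by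
      intro h1
      have := congrArg natDegree h1
      rw [Affine.natDegree_polynomial, natDegree_one] at this
      exact two_ne_zero this)
    rw [Affine.natDegree_polynomial] at h1
    omega
  have hr := eq_X_add_C_of_natDegree_le_one hdeg
  have e := modByMonic_add_div p V.toAffine.polynomial
  have h0 : V.toAffine.polynomial.evalEval x y = 0 := h
  have e' : p.evalEval x y = (p %ₘ V.toAffine.polynomial).evalEval x y := by
    nth_rw 1 [← e]
    rw [evalEval_add, evalEval_mul, h0, zero_mul, add_zero]
  rw [e', hr, evalEval_add, evalEval_mul, evalEval_C, evalEval_C, evalEval_X]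
  simp only [linCoeff]
  ring

/-- With `αₘ := r₀(ω̃ₘψₘ)`, `βₘ := r₁(ω̃ₘψₘ)`: on the curve `ωₘ(x, y)ψₘ(x, y) = αₘ(x) + βₘ(x)y`.
[folklore] -/
theorem evalEval_ωPoly_mul_ψ {x y : K} (h : V.toAffine.Equation x y) (m : ℤ) :
    Affine.Point.ωEval V x y m * (V.ψ m).evalEval x y =
      (V.linCoeff (V.ωPoly m * V.ψ m) 0).eval x +
        (V.linCoeff (V.ωPoly m * V.ψ m) 1).eval x * y := by
  rw [← V.evalEval_eq_linCoeff h, evalEval_mul, evalEval_ωPoly]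

/-- **Linearisation of `y ∘ [m]`.** If `[m](x, y) = (u, v)` then
`v · ΨSqₘ(x)² = αₘ(x) + βₘ(x) · y`, from `[m](x, y) = (φₘ/ψₘ², ωₘ/ψₘ³)(x, y)` (tree theorem
`Affine.Point.zsmul_some_eq_of_evalEval_ψ_ne_zero`) and `ψₘ(x, y)² = ΨSqₘ(x)` on the curve.
Silverman, *AEC*, Exercise 3.7(d). [cite: SilvermanAEC2009, Exercise 3.7(d)] -/
theorem mul_eval_ΨSq_sq_of_zsmul_eq {x y : K} (h : V.toAffine.Nonsingular x y) {m : ℤ} {u v : K}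
    (hu : V.toAffine.Nonsingular u v)
    (hm : m • (Affine.Point.some x y h : V.toAffine.Point) = Affine.Point.some u v hu) :
    v * ((V.ΨSq m).eval x) ^ 2 =
      (V.linCoeff (V.ωPoly m * V.ψ m) 0).eval x +
        (V.linCoeff (V.ωPoly m * V.ψ m) 1).eval x * y := by
  have hψ : (V.ψ m).evalEval x y ≠ 0 := fun h0 ↦ by
    have := (Affine.Point.zsmul_some_eq_zero_iff h m).mpr h0
    rw [hm] at this
    exact Affine.Point.some_ne_zero _ this
  obtain ⟨hns, e⟩ := Affine.Point.zsmul_some_eq_of_evalEval_ψ_ne_zero h (n := m) hψ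
  rw [hm] at e
  obtain ⟨-, hv⟩ := (Affine.Point.some.injEq _ _ _ _ _ _).mp e
  rw [← V.evalEval_ωPoly_mul_ψ h.1, ← V.evalEval_ψ_sq h.1, hv]
  field_simp

/-- **`βₘ ≠ 0`** for `m ≠ 0` on an elliptic curve over an algebraically closed field: otherwise
`y([m]P)` would depend on `x(P)` only, forcing `[m]P = [m](−P) = −[m]P`, i.e. `[2m]P = O`, for
every `P`, whereas `E[2m]` is finite (tree: `finite_torsionBy_of_isAlgClosed`) and `E(K)` is
infinite (tree: `infinite_point`). [folklore] -/
theorem linCoeff_one_ne_zero [IsAlgClosed K] [V.IsElliptic] {m : ℤ} (hm : m ≠ 0) :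
    V.linCoeff (V.ωPoly m * V.ψ m) 1 ≠ 0 := by
  intro hβ
  have key : ∀ P : V.toAffine.Point, (2 * m) • P = 0 := by
    rintro (_ | ⟨x, y, h⟩)
    · exact zsmul_zero _
    · rcases hmP : m • (Affine.Point.some x y h : V.toAffine.Point) with _ | ⟨u, v, hu⟩
      · rw [mul_zsmul, hmP, ← Affine.Point.zero_def, zsmul_zero]
      · have hneg : m • (Affine.Point.some x (V.toAffine.negY x y)
            ((Affine.nonsingular_neg x y).mpr h) : V.toAffine.Point) =
              Affine.Point.some u (V.toAffine.negY u v) ((Affine.nonsingular_neg u v).mpr hu) := by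
          rw [← Affine.Point.neg_some h, zsmul_neg, hmP, Affine.Point.neg_some]
        have e1 := V.mul_eval_ΨSq_sq_of_zsmul_eq h hu hmP
        have e2 := V.mul_eval_ΨSq_sq_of_zsmul_eq ((Affine.nonsingular_neg x y).mpr h)
          ((Affine.nonsingular_neg u v).mpr hu) hneg
        rw [hβ, eval_zero, zero_mul, add_zero] at e1 e2
        have hΨ : (V.ΨSq m).eval x ≠ 0 := fun h0 ↦ by
          have := (V.zsmul_some_eq_zero_iff_eval_ΨSq h m).mpr h0
          rw [hmP] at this
          exact Affine.Point.some_ne_zero _ this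
        have hv : v = V.toAffine.negY u v :=
          mul_right_cancel₀ (pow_ne_zero 2 hΨ) (e1.trans e2.symm)
        have hPP : m • (Affine.Point.some x y h : V.toAffine.Point) =
            -(m • (Affine.Point.some x y h : V.toAffine.Point)) := by
          rw [hmP, Affine.Point.neg_some]
          exact Affine.Point.some.injEq _ _ _ _ _ _ |>.mpr ⟨rfl, hv⟩
        rw [mul_zsmul, two_zsmul]
        nth_rw 2 [hPP]
        exact add_neg_cancel _
  haveI := V.finite_torsionBy_of_isAlgClosed (n := 2 * m) (mul_ne_zero two_ne_zero hm)
  haveI := V.infinite_point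
  haveI : Finite V.toAffine.Point := Finite.of_injective
    (fun P ↦ (⟨P, (Literature.NumberTheory.EllipticCurves.mem_torsionBy_iff).mpr (key P)⟩ :
      AddSubgroup.torsionBy V.toAffine.Point (2 * m))) fun P Q e ↦ congrArg Subtype.val e
  exact _root_.not_finite V.toAffine.Point

/-- **The fibre of `[m]` above a generic point.** Let `E` be elliptic over an algebraically closed
field, `m ≠ 0` in `K`, and `Q = (u, v)` a point with `2Q ≠ O`. Then there are `m²` affine
points `(xᵢ, yᵢ)` with `[m](xᵢ, yᵢ) = Q` (a coset of `E[m]`, `#E[m] = m²`: tree theorem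
`card_torsionBy_eq_sq`, *AEC* III.6.4(b)) such that `Φₘ − u·ΨSqₘ = ∏ᵢ (T − xᵢ)`: the `xᵢ` are
pairwise distinct (`xᵢ = xⱼ` forces `Pᵢ = ±Pⱼ`, and `Pᵢ = −Pⱼ` gives `2Q = O`), they are roots
(`x([m]P)·ΨSqₘ(x) = Φₘ(x)`, tree theorem `mul_eval_ΨSq_of_zsmul_eq`), and the left side is
monic of degree `m²` (Mathlib `leadingCoeff_Φ`, `natDegree_Φ`, `natDegree_ΨSq_le`). This is the
fibre count `#[m]⁻¹(Q) = deg [m]` of Silverman, *AEC*, III.4.10(a),(c) for the separable `[m]`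
(Cor. III.5.4), made explicit.
[cite: SilvermanAEC2009, Cor. III.6.4(b) with Exercise 3.7(d); cf. Thm. III.4.10(c)] -/
theorem exists_fibre_prod_eq [IsAlgClosed K] [V.IsElliptic] {m : ℕ} (hm : (m : K) ≠ 0) {u v : K}
    (hu : V.toAffine.Nonsingular u v)
    (h2 : (2 : ℤ) • (Affine.Point.some u v hu : V.toAffine.Point) ≠ 0) :
    ∃ (x y : Fin (m ^ 2) → K) (h : ∀ i, V.toAffine.Nonsingular (x i) (y i)),
      (∀ i, (m : ℤ) • (Affine.Point.some (x i) (y i) (h i) : V.toAffine.Point) =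
        Affine.Point.some u v hu) ∧
      V.Φ m - C u * V.ΨSq m = ∏ i, (X - C (x i)) := by
  have hm0 : m ≠ 0 := by rintro rfl; exact hm Nat.cast_zero
  set Q : V.toAffine.Point := Affine.Point.some u v hu with hQ
  obtain ⟨P₀, hP₀⟩ := V.nsmul_surjective_of_isAlgClosed hm0 Q
  haveI := V.finite_torsionBy_of_isAlgClosed (n := (m : ℤ)) (by exact_mod_cast hm0)
  have hcard := card_torsionBy_eq_sq (E := V) hm
  set e := (Finite.equivFinOfCardEq hcard).symm with he
  set P : Fin (m ^ 2) → V.toAffine.Point := fun i ↦ (e i : V.toAffine.Point) + P₀ with hP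
  have hPi : ∀ i, (m : ℤ) • P i = Q := fun i ↦ by
    have h1 : (m : ℤ) • (e i : V.toAffine.Point) = 0 := (Literature.NumberTheory.EllipticCurves.mem_torsionBy_iff).mp (e i).2
    rw [hP, zsmul_add, h1, zero_add, natCast_zsmul]
    exact hP₀
  have hP0 : ∀ i, P i ≠ 0 := fun i h0 ↦ by
    have := hPi i
    rw [h0, zsmul_zero] at this
    exact Affine.Point.some_ne_zero _ this.symm
  have hcoord : ∀ i, ∃ x y h, P i = Affine.Point.some x y h := fun i ↦ by
    rcases hi : P i with _ | ⟨x, y, h⟩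
    · exact (hP0 i hi).elim
    · exact ⟨x, y, h, rfl⟩
  choose x y h hPxy using hcoord
  have hPi' : ∀ i, (m : ℤ) • (Affine.Point.some (x i) (y i) (h i) : V.toAffine.Point) = Q :=
    fun i ↦ by rw [← hPxy]; exact hPi i
  refine ⟨x, y, h, hPi', ?_⟩
  -- the abscissae are pairwise distinct
  have hinj : Function.Injective x := by
    intro i j hij
    rcases (Affine.Point.X_eq_iff (h₁ := h i) (h₂ := h j)).mp hij with e1 | e1
    · rw [← hPxy, ← hPxy, hP] at e1
      exact e.injective (Subtype.ext (add_right_cancel e1))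
    · exfalso
      apply h2
      have h3 := hPi' i
      rw [e1, zsmul_neg, hPi'] at h3
      rw [two_zsmul]
      nth_rw 1 [← h3]
      exact neg_add_cancel Q
  -- they are roots of `F = Φₘ - u ΨSqₘ`, monic of degree `m²`
  set F := V.Φ m - C u * V.ΨSq m with hF
  have hroot : ∀ i, F.IsRoot (x i) := fun i ↦ by
    have := V.mul_eval_ΨSq_of_zsmul_eq (h i) m hu (hPi' i)
    simp only [hF, IsRoot, eval_sub, eval_mul, eval_C, this, sub_self]
  have hnat : ((m : ℤ)).natAbs = m := Int.natAbs_natCast m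
  have hdegΦ : (V.Φ m).natDegree = m ^ 2 := by rw [natDegree_Φ, hnat]
  have hlt : (C u * V.ΨSq m).natDegree < (V.Φ m).natDegree := by
    refine (natDegree_C_mul_le _ _).trans_lt ((V.natDegree_ΨSq_le m).trans_lt ?_)
    rw [hdegΦ, hnat]
    have : 1 ≤ m ^ 2 := Nat.one_le_pow _ _ (Nat.pos_of_ne_zero hm0)
    omega
  have hFmonic : F.Monic := by
    have hΦ : (V.Φ m).Monic := leadingCoeff_Φ V m
    exact hΦ.sub_of_left (degree_lt_degree hlt)
  have hFdeg : F.natDegree = m ^ 2 := by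
    rw [hF, natDegree_sub_eq_left_of_natDegree_lt hlt, hdegΦ]
  have hF0 : F ≠ 0 := hFmonic.ne_zero
  have hdvd : (∏ i, (X - C (x i))) ∣ F := by
    have : (∏ i, (X - C (x i))) =
        (((Finset.univ : Finset (Fin (m ^ 2))).val.map x).map fun a ↦ X - C a).prod := by
      rw [Multiset.map_map, Finset.prod_eq_multiset_prod]; rfl
    rw [this, Multiset.prod_X_sub_C_dvd_iff_le_roots hF0,
      Multiset.le_iff_subset (Finset.univ.nodup.map hinj)]
    intro a ha
    obtain ⟨i, -, rfl⟩ := Multiset.mem_map.mp ha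
    exact (mem_roots hF0).mpr (hroot i)
  refine eq_of_monic_of_dvd_of_natDegree_le (monic_prod_X_sub_C x _) hFmonic hdvd ?_
  rw [natDegree_finsetProd_X_sub_C_eq_card, Finset.card_univ, Fintype.card_fin, hFdeg]

/-! ## The trace construction over `K[u, v]` -/

/-- `F = Φₘ − u·ΨSqₘ ∈ K[u, v][T]` (`u = X 0`): its specialisation at `(u, v) = (x(Q), y(Q))` is
the monic polynomial whose roots are the abscissae of `[m]⁻¹(Q)`. [folklore] -/
def nsmulFibrePoly (m : ℤ) : (MvPolynomial (Fin 2) K)[X] :=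
  (V.Φ m).map MvPolynomial.C - C (MvPolynomial.X 0) * (V.ΨSq m).map MvPolynomial.C

/-- For `N ≡ n₀ + n₁Y` modulo the Weierstrass equation, the polynomial
`Ñ = n₀βₘ + n₁(v·ΨSqₘ² − αₘ) ∈ K[u, v][T]` (`v = X 1`): at a point `(x, y)` with
`[m](x, y) = (u, v)` one has `Ñ(x) = βₘ(x)·N(x, y)` (`eval_yElimPoly_of_zsmul_eq`), i.e. `Ñ/βₘ`
is `N` with `y` eliminated. [folklore] -/
def yElimPoly (m : ℤ) (N : K[X][Y]) : (MvPolynomial (Fin 2) K)[X] :=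
  (V.linCoeff N 0).map MvPolynomial.C * (V.linCoeff (V.ωPoly m * V.ψ m) 1).map MvPolynomial.C +
    (V.linCoeff N 1).map MvPolynomial.C *
      (C (MvPolynomial.X 1) * ((V.ΨSq m).map MvPolynomial.C) ^ 2 -
        (V.linCoeff (V.ωPoly m * V.ψ m) 0).map MvPolynomial.C)

/-- The numerator `A ∈ K[u, v]` of the trace `∑_{[m]P = (u,v)} (Pn/Qd)(P)` of the fraction `Pn/Qd`
of two-variable polynomials (`Literature.NumberTheory.EllipticCurves.traceDescend` for `F`, `Ñ`, `D̃`). [folklore] -/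
def nsmulTraceNum (m : ℕ) (Pn Qd : MvPolynomial (Fin 2) K) : MvPolynomial (Fin 2) K :=
  Literature.NumberTheory.EllipticCurves.traceDescend (m ^ 2) (V.nsmulFibrePoly m)
    (V.yElimPoly m ((Bivariate.equivMvPolynomial K).symm Pn))
    (V.yElimPoly m ((Bivariate.equivMvPolynomial K).symm Qd))

/-- The denominator `m² · B ∈ K[u, v]` (`Literature.NumberTheory.EllipticCurves.normDescend` for `F`, `D̃`). [folklore] -/
def nsmulTraceDen (m : ℕ) (Qd : MvPolynomial (Fin 2) K) : MvPolynomial (Fin 2) K :=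
  MvPolynomial.C ((m : K) ^ 2) *
    Literature.NumberTheory.EllipticCurves.normDescend (m ^ 2) (V.nsmulFibrePoly m)
      (V.yElimPoly m ((Bivariate.equivMvPolynomial K).symm Qd))

variable {V}

/-- `F` specialises to `Φₘ − u·ΨSqₘ`. [folklore] -/
theorem map_eval_nsmulFibrePoly (m : ℤ) (u v : K) :
    (V.nsmulFibrePoly m).map (MvPolynomial.eval ![u, v]) = V.Φ m - C u * V.ΨSq m := by
  simp only [nsmulFibrePoly, Polynomial.map_sub, Polynomial.map_mul, Polynomial.map_C,
    Literature.NumberTheory.EllipticCurves.map_map_C_eval, MvPolynomial.eval_X, Matrix.cons_val_zero]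

/-- `Ñ` specialises to `n₀βₘ + n₁(v·ΨSqₘ² − αₘ)`. [folklore] -/
theorem eval_map_eval_yElimPoly (m : ℤ) (N : K[X][Y]) (u v t : K) :
    ((V.yElimPoly m N).map (MvPolynomial.eval ![u, v])).eval t =
      (V.linCoeff N 0).eval t * (V.linCoeff (V.ωPoly m * V.ψ m) 1).eval t +
        (V.linCoeff N 1).eval t *
          (v * ((V.ΨSq m).eval t) ^ 2 - (V.linCoeff (V.ωPoly m * V.ψ m) 0).eval t) := by
  simp only [yElimPoly, Polynomial.map_add, Polynomial.map_sub, Polynomial.map_mul,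
    Polynomial.map_pow, Polynomial.map_C, Literature.NumberTheory.EllipticCurves.map_map_C_eval, MvPolynomial.eval_X,
    Matrix.cons_val_one, Matrix.cons_val_zero, eval_add, eval_sub, eval_mul, eval_pow, eval_C]

/-- **`y`-elimination**: at a point `(x, y)` with `[m](x, y) = (u, v)`, `Ñ(x) = βₘ(x) · N(x, y)`.
[folklore] -/
theorem eval_yElimPoly_of_zsmul_eq {x y : K} (h : V.toAffine.Nonsingular x y) {m : ℤ} {u v : K}
    (hu : V.toAffine.Nonsingular u v)
    (hm : m • (Affine.Point.some x y h : V.toAffine.Point) = Affine.Point.some u v hu)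
    (N : K[X][Y]) :
    ((V.yElimPoly m N).map (MvPolynomial.eval ![u, v])).eval x =
      (V.linCoeff (V.ωPoly m * V.ψ m) 1).eval x * N.evalEval x y := by
  rw [eval_map_eval_yElimPoly, V.evalEval_eq_linCoeff h.1 N, V.mul_eval_ΨSq_sq_of_zsmul_eq h hu hm]
  ring

/-- **The trace of a fraction over a fibre of `[m]` is a rational function of the base point.**
Let `(xᵢ, yᵢ)`, `i < m²`, be points with `[m](xᵢ, yᵢ) = (u, v)`, `Φₘ − u·ΨSqₘ = ∏ (T − xᵢ)` and
`βₘ(xᵢ) ≠ 0`, and let `Pn/Qd` be a fraction of two-variable polynomials taking one and the same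
value `c` at every `(xᵢ, yᵢ)` (with `Qd(xᵢ, yᵢ) ≠ 0`). Then `nsmulTraceDen(u, v) ≠ 0` and
`nsmulTraceNum(u, v) = c · nsmulTraceDen(u, v)` (`m ≠ 0` in `K`). [folklore] -/
theorem eval_nsmulTraceNum_eq {m : ℕ} (hm : (m : K) ≠ 0) {u v : K} (hu : V.toAffine.Nonsingular u v)
    {x y : Fin (m ^ 2) → K} (h : ∀ i, V.toAffine.Nonsingular (x i) (y i))
    (hfib : ∀ i, (m : ℤ) • (Affine.Point.some (x i) (y i) (h i) : V.toAffine.Point) =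
      Affine.Point.some u v hu)
    (hprod : V.Φ m - C u * V.ΨSq m = ∏ i, (X - C (x i)))
    (hβ : ∀ i, (V.linCoeff (V.ωPoly m * V.ψ m) 1).eval (x i) ≠ 0)
    {Pn Qd : MvPolynomial (Fin 2) K} {c : K}
    (hQd : ∀ i, MvPolynomial.eval ![x i, y i] Qd ≠ 0)
    (hPn : ∀ i, MvPolynomial.eval ![x i, y i] Pn = c * MvPolynomial.eval ![x i, y i] Qd) :
    MvPolynomial.eval ![u, v] (V.nsmulTraceDen m Qd) ≠ 0 ∧
      MvPolynomial.eval ![u, v] (V.nsmulTraceNum m Pn Qd) =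
        c * MvPolynomial.eval ![u, v] (V.nsmulTraceDen m Qd) := by
  have hx : (V.nsmulFibrePoly m).map (MvPolynomial.eval ![u, v]) = ∏ i, (X - C (x i)) := by
    rw [map_eval_nsmulFibrePoly]; exact hprod
  obtain ⟨hB, hA⟩ := Literature.NumberTheory.EllipticCurves.map_traceDescend_eq_of_forall_eq (d := m ^ 2) (V.nsmulFibrePoly m)
    (V.yElimPoly m ((Bivariate.equivMvPolynomial K).symm Pn))
    (V.yElimPoly m ((Bivariate.equivMvPolynomial K).symm Qd)) (MvPolynomial.eval ![u, v]) x hx c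
    (fun i ↦ by
      rw [eval_yElimPoly_of_zsmul_eq (h i) hu (hfib i), ← eval_eq_evalEval_equivMvPolynomial_symm]
      exact mul_ne_zero (hβ i) (hQd i))
    (fun i ↦ by
      rw [eval_yElimPoly_of_zsmul_eq (h i) hu (hfib i),
        eval_yElimPoly_of_zsmul_eq (h i) hu (hfib i), ← eval_eq_evalEval_equivMvPolynomial_symm,
        ← eval_eq_evalEval_equivMvPolynomial_symm, hPn i]
      ring)
  refine ⟨?_, ?_⟩
  · simp only [nsmulTraceDen, map_mul, MvPolynomial.eval_C]
    exact mul_ne_zero (pow_ne_zero 2 hm) hB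
  · simp only [nsmulTraceNum, nsmulTraceDen, map_mul, MvPolynomial.eval_C, hA]
    push_cast
    ring

end Curve

/-! ## The factorisation `ψ = λ ∘ [m]` on geometric points -/

open geomPoints Literature.NumberTheory.EllipticCurves

universe u

section Factor

variable {K : Type u} [Field K] {W W' : WeierstrassCurve K} {m : ℕ}

/-- An isogeny killing `E[m]` is constant on the fibres of `[m]`. [folklore] -/
theorem Isogeny.apply_eq_of_nsmul_eq (ψ : Isogeny W W') (hψ : ∀ P ∈ geomTorsion W m, ψ P = 0)
    {P P' : W.geomPoints} (h : m • P = m • P') : ψ P = ψ P' := by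
  have hmem : P - P' ∈ geomTorsion W m := by
    rw [Literature.NumberTheory.EllipticCurves.mem_torsionBy_iff, natCast_zsmul, nsmul_sub, h, sub_self]
  have := hψ _ hmem
  rwa [map_sub, sub_eq_zero] at this

variable [W.IsElliptic]

variable (W) in
/-- A (set-theoretic) section `Q ↦ P_Q` of `P ↦ m • P` on `E(K̄)`, `m ≠ 0`: some point `P_Q` with
`m • P_Q = Q` (`nsmul_nsmulSection`), which exists because `[m]` is onto `E(K̄)` (tree theorem
`nsmul_surjective_of_isAlgClosed` of `PointDivisibilityProofs`; Silverman, *AEC*, II.2.3 with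
III.4.2(a)). Junk-free: every value is a genuine preimage. [folklore] -/
def nsmulSection (hm : m ≠ 0) : W.geomPoints → W.geomPoints :=
  Function.surjInv ((W.baseChange (AlgebraicClosure K)).nsmul_surjective_of_isAlgClosed hm)

variable (W) in
/-- `m • P_Q = Q` for the chosen preimage `P_Q = nsmulSection Q` of `Q` under `[m]`. [folklore] -/
theorem nsmul_nsmulSection (hm : m ≠ 0) (Q : W.geomPoints) : m • W.nsmulSection hm Q = Q :=
  Function.surjInv_eq ((W.baseChange (AlgebraicClosure K)).nsmul_surjective_of_isAlgClosed hm) Q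

namespace Isogeny

variable (ψ : Isogeny W W') (hm : m ≠ 0) (hψ : ∀ P ∈ geomTorsion W m, ψ P = 0)
include hm hψ

/-- The map `λ : E(K̄) → E'(K̄)` with `λ(mP) = ψ(P)`, for an isogeny `ψ` killing `E[m]`, `m ≠ 0`
(well defined because `[m]` is onto `E(K̄)` and `ψ` is constant on its fibres), as an additive
map. Silverman, *AEC*, Cor. III.4.11 (the map `λ`). [folklore] -/
def factorNsmulHom : W.geomPoints →+ W'.geomPoints where
  toFun Q := ψ (W.nsmulSection hm Q)
  map_zero' := by
    rw [← map_zero ψ]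
    refine ψ.apply_eq_of_nsmul_eq hψ ?_
    rw [nsmul_nsmulSection W hm 0, smul_zero]
  map_add' Q Q' := by
    rw [← map_add ψ]
    refine ψ.apply_eq_of_nsmul_eq hψ ?_
    rw [smul_add, nsmul_nsmulSection W hm, nsmul_nsmulSection W hm, nsmul_nsmulSection W hm]

/-- `λ(mP) = ψ(P)`. [folklore] -/
theorem factorNsmulHom_nsmul (P : W.geomPoints) : ψ.factorNsmulHom hm hψ (m • P) = ψ P :=
  ψ.apply_eq_of_nsmul_eq hψ (nsmul_nsmulSection W hm (m • P))

/-- `λ(Q) = ψ(P)` for any `P` with `mP = Q`. [folklore] -/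
theorem factorNsmulHom_eq_of_nsmul_eq {P Q : W.geomPoints} (h : m • P = Q) :
    ψ.factorNsmulHom hm hψ Q = ψ P := by
  rw [← h, factorNsmulHom_nsmul]

/-- `λ` commutes with the Galois action (because `ψ` and `[m]` do). [folklore] -/
theorem factorNsmulHom_smul (σ : Field.absoluteGaloisGroup K) (Q : W.geomPoints) :
    ψ.factorNsmulHom hm hψ (σ • Q) = σ • ψ.factorNsmulHom hm hψ Q := by
  obtain ⟨P, rfl⟩ : ∃ P : W.geomPoints, m • P = Q := ⟨_, nsmul_nsmulSection W hm Q⟩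
  rw [factorNsmulHom_nsmul, smul_comm σ m P, factorNsmulHom_nsmul, ψ.map_smul]

/-- `ker λ ⊆ [m](ker ψ)` is finite. [folklore] -/
theorem finite_ker_factorNsmulHom :
    ((ψ.factorNsmulHom hm hψ).ker : Set W.geomPoints).Finite := by
  refine (ψ.finite_ker.image fun P : W.geomPoints ↦ m • P).subset fun Q hQ ↦ ?_
  obtain ⟨P, rfl⟩ : ∃ P : W.geomPoints, m • P = Q := ⟨_, nsmul_nsmulSection W hm Q⟩
  refine ⟨P, ?_, rfl⟩
  rw [SetLike.mem_coe, AddMonoidHom.mem_ker] at hQ ⊢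
  rwa [factorNsmulHom_nsmul] at hQ

/-- **`λ` is given by a rational map off a finite set.** With `ψ = (P₁/Q₁, P₂/Q₂)` off the finite
set `S`, the map `λ` agrees with the rational map
`(nsmulTraceNum P₁ Q₁ / nsmulTraceDen Q₁, nsmulTraceNum P₂ Q₂ / nsmulTraceDen Q₂)` at every `Q`
outside `{O} ∪ E[2] ∪ [m](S) ∪ [m]{βₘ(x) = 0}`: the coordinates of `λ(Q) = ψ(Pᵢ)` are the
common values of `P₁/Q₁`, `P₂/Q₂` at the `m²` points `Pᵢ` of `[m]⁻¹(Q)`, hence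
(`eval_nsmulTraceNum_eq`) the values of those fractions at `Q`. Silverman, *AEC*, Cor. III.4.11 (for
`φ = [m]`, separable by Cor. III.5.4), whose printed proof via III.4.10(b) — a function invariant
under the translations by `ker [m]` lies in `[m]^* K̄(E)` — is made explicit by the trace.
[folklore] -/
theorem isAlgebraicOn_factorNsmulHom (hmK : (m : K) ≠ 0) :
    IsAlgebraicOn W W' (ψ.factorNsmulHom hm hψ) := by
  obtain ⟨P₁, Q₁, P₂, Q₂, hS⟩ := ψ.isAlgebraic
  have hmk : (m : AlgebraicClosure K) ≠ 0 := by
    rw [← map_natCast (algebraMap K (AlgebraicClosure K)) m]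
    exact (_root_.map_ne_zero _).mpr hmK
  have hβ0 : (W.baseChange (AlgebraicClosure K)).linCoeff
      ((W.baseChange (AlgebraicClosure K)).ωPoly m *
        (W.baseChange (AlgebraicClosure K)).ψ m) 1 ≠ 0 :=
    linCoeff_one_ne_zero _ (by exact_mod_cast hm)
  refine ⟨(W.baseChange (AlgebraicClosure K)).nsmulTraceNum m P₁ Q₁,
    (W.baseChange (AlgebraicClosure K)).nsmulTraceDen m Q₁,
    (W.baseChange (AlgebraicClosure K)).nsmulTraceNum m P₂ Q₂,
    (W.baseChange (AlgebraicClosure K)).nsmulTraceDen m Q₂, ?_⟩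
  -- the finite exceptional set `{O} ∪ E[2] ∪ [m](S) ∪ [m]{β = 0}`
  set Zβ : Set W.geomPoints := {P | ∃ x y h,
    P = (Affine.Point.some x y h : W.geomPoints) ∧ x ∈ {a | IsRoot ((W.baseChange
      (AlgebraicClosure K)).linCoeff ((W.baseChange (AlgebraicClosure K)).ωPoly m *
        (W.baseChange (AlgebraicClosure K)).ψ m) 1) a}} with hZβ
  have hZβfin : Zβ.Finite :=
    (W.baseChange (AlgebraicClosure K)).finite_setOf_X_mem (Polynomial.finite_setOf_isRoot hβ0)
  have h2fin : {Q : W.geomPoints | (2 : ℤ) • Q = 0}.Finite := by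
    haveI : Finite (geomTorsion W 2) :=
      (W.baseChange (AlgebraicClosure K)).finite_torsionBy_of_isAlgClosed two_ne_zero
    exact ((geomTorsion W 2 : Set W.geomPoints).toFinite).subset
      fun Q hQ ↦ (Literature.NumberTheory.EllipticCurves.mem_torsionBy_iff).mpr hQ
  refine (((Set.finite_singleton (0 : W.geomPoints)).union h2fin).union
    ((hS.image fun P ↦ m • P).union (hZβfin.image fun P ↦ m • P))).subset fun Q hQ ↦ ?_
  by_contra hbad
  simp only [Set.mem_union, Set.mem_singleton_iff, Set.mem_setOf_eq, Set.mem_image, not_or,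
    not_exists, not_and] at hbad
  obtain ⟨⟨hQ0, h2Q⟩, hQS, hQβ⟩ := hbad
  apply hQ
  -- coordinates of `Q`
  obtain ⟨u, v, hu, rfl⟩ : ∃ u v hu, Q = (Affine.Point.some u v hu : W.geomPoints) := by
    cases Q with
    | zero => exact (hQ0 rfl).elim
    | some u v hu => exact ⟨u, v, hu, rfl⟩
  -- the fibre of `[m]` above `Q`
  obtain ⟨x, y, h, hfib, hprod⟩ :=
    (W.baseChange (AlgebraicClosure K)).exists_fibre_prod_eq hmk hu h2Q
  set P : Fin (m ^ 2) → W.geomPoints :=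
    fun i ↦ (Affine.Point.some (x i) (y i) (h i) : W.geomPoints) with hP
  have hPQ : ∀ i, m • P i = (Affine.Point.some u v hu : W.geomPoints) := fun i ↦ by
    have := hfib i
    rw [natCast_zsmul] at this
    exact this
  have hlam : ∀ i, ψ.factorNsmulHom hm hψ (Affine.Point.some u v hu : W.geomPoints) = ψ (P i) :=
    fun i ↦ ψ.factorNsmulHom_eq_of_nsmul_eq hm hψ (hPQ i)
  have hagree : ∀ i, AgreesWithRationalMapAt W W' P₁ Q₁ P₂ Q₂ ψ (P i) := fun i ↦ by
    by_contra hi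
    exact hQS (P i) hi (hPQ i)
  have hβi : ∀ i, ((W.baseChange (AlgebraicClosure K)).linCoeff
      ((W.baseChange (AlgebraicClosure K)).ωPoly m *
        (W.baseChange (AlgebraicClosure K)).ψ m) 1).eval (x i) ≠ 0 :=
    fun i h0 ↦ hQβ (P i) ⟨x i, y i, h i, rfl, h0⟩ (hPQ i)
  -- the value `λ(Q) = ψ(P_{i₀})`
  have i₀ : Fin (m ^ 2) := ⟨0, pow_pos (Nat.pos_of_ne_zero hm) 2⟩
  obtain ⟨-, x', y', h', hψP, -, -⟩ := (hagree i₀).exists_hasValue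
  have hlamQ : ψ.factorNsmulHom hm hψ (Affine.Point.some u v hu : W.geomPoints) =
      (Affine.Point.some x' y' h' : W'.geomPoints) := (hlam i₀).trans hψP
  -- the fractions `P₁/Q₁`, `P₂/Q₂` take the values `x'`, `y'` at every `Pᵢ`
  have hvals : ∀ i, RatFrac.HasValue ⟨P₁, Q₁⟩ ![x i, y i] x' ∧
      RatFrac.HasValue ⟨P₂, Q₂⟩ ![x i, y i] y' := fun i ↦ by
    obtain ⟨-, x'', y'', h'', hψPi, hx', hy'⟩ := (hagree i).exists_hasValue
    have e : (Affine.Point.some x'' y'' h'' : W'.geomPoints) = Affine.Point.some x' y' h' :=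
      hψPi.symm.trans (((hlam i).symm).trans hlamQ)
    obtain ⟨rfl, rfl⟩ := (Affine.Point.some.injEq _ _ _ _ _ _).mp e
    exact ⟨hx', hy'⟩
  obtain ⟨hD₁, hN₁⟩ := eval_nsmulTraceNum_eq hmk hu h hfib hprod hβi
    (fun i ↦ (hvals i).1.1) (fun i ↦ (hvals i).1.2)
  obtain ⟨hD₂, hN₂⟩ := eval_nsmulTraceNum_eq hmk hu h hfib hprod hβi
    (fun i ↦ (hvals i).2.1) (fun i ↦ (hvals i).2.2)
  exact agreesWithRationalMapAt_of_hasValue (Affine.Point.some_ne_zero hu) hlamQ ⟨hD₁, hN₁⟩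
    ⟨hD₂, hN₂⟩

/-- **The isogeny `λ` with `ψ = λ ∘ [m]`** (Silverman, *AEC*, Cor. III.4.11 for `φ = [m]`,
separable by Cor. III.5.4): for an isogeny `ψ` over `K` killing `E[m]`, `m ≠ 0` in `K`, the map
`λ(mP) := ψ(P)` on `E(K̄)` is additive, algebraic (`isAlgebraicOn_factorNsmulHom`),
`Γ_K`-equivariant and has finite kernel, i.e. it is an isogeny over `K` in the sense of the prelude
`Isogeny`. [cite: SilvermanAEC2009, Cor. III.4.11 with Cor. III.5.4] -/
def factorNsmul (hmK : (m : K) ≠ 0) : Isogeny W W' where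
  toAddMonoidHom := ψ.factorNsmulHom hm hψ
  isAlgebraic := ψ.isAlgebraicOn_factorNsmulHom hm hψ hmK
  equivariant := ψ.factorNsmulHom_smul hm hψ
  finite_ker := ψ.finite_ker_factorNsmulHom hm hψ

/-- `ψ = λ ∘ [m]` on `E(K̄)`. [cite: SilvermanAEC2009, Cor. III.4.11] -/
theorem factorNsmul_nsmul (hmK : (m : K) ≠ 0) (P : W.geomPoints) :
    ψ.factorNsmul hm hψ hmK (m • P) = ψ P :=
  ψ.factorNsmulHom_nsmul hm hψ P

end Isogeny

end Factor

/-! ## Discharge of the named fact -/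

variable {K : Type u} [Field K] (W W' : WeierstrassCurve K)

/-- **Discharge of `WeierstrassCurve.Isogeny.exists_eq_comp_nsmul_of_geomTorsion_le_ker`**
(Silverman, *AEC*, Cor. III.4.11 applied to the separable isogeny `φ = [m]`, Cor. III.5.4): an
isogeny `ψ : E → E'` over `K` with `E[m] ⊆ ker ψ`, `m ≠ 0` in `K`, factors as `ψ = λ ∘ [m]` for an
isogeny `λ : E → E'` over `K` — namely `λ = ψ.factorNsmul`.
[cite: SilvermanAEC2009, Cor. III.4.11 with Cor. III.5.4] -/
theorem Isogeny.exists_eq_comp_nsmul_of_geomTorsion_le_ker_holds :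
    Isogeny.exists_eq_comp_nsmul_of_geomTorsion_le_ker W W' := by
  intro _ _ m hmK ψ hψ
  have hm : m ≠ 0 := by rintro rfl; exact hmK Nat.cast_zero
  exact ⟨ψ.factorNsmul hm hψ hmK, fun P ↦ (ψ.factorNsmul_nsmul hm hψ hmK P).symm⟩

end WeierstrassCurve
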